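import Summits.QuantumFields.BalabanUV.T4Continuum.Support.NE3SpectralCut
import HarnessLib

/-!
# NE3SpectralCutSymmetry (T⁴ programme, node NE3, row K1-inst of the owner's ruling ρ-g22-2, file 1∕4) — ABSTRACT SUPPLEMENT TO THE
# SPECTRAL-CUT KIT: LINEARITY OF THE PARTS, PLAIN-NORM PYTHAGORAS, AND «THE CUT COMMUTES WITH EVERY LINEAR MAP COMMUTING WITH `T`»

NE3 (node U1b) formalisation swarm `b2b-balaban-t4-ne3-formalise-*`, leaf seat `b2b-balaban-t4-ne3-formalise-leaf-02` (gen 6), row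
**K1-inst** of the owner's ruling ρ-g22-2 («package `D_W` on periodic 𝔤-valued sections as a `LinearMap` between `PiLp` spaces», owner journal
l.17786 ∕ l.18064; design `HOME/t4/b2b-balaban-t4-ne3-p1/g22/D-ne3p1-g22-1.md` steps S1∕S2; my INTENT ∕ CLAIM `HOME/CLAIMS.log` l.18383).
THE ROW'S FILES: (1∕4) `NE3SpectralCutSymmetry` (abstract supplement to the owner's kit `NE3SpectralCut` p227224 ∕ `NE3SpectralCutGram` p227494),
(2∕4) `NE3HilbertSchmidtTorus` (the real Hilbert–Schmidt `PiLp` packaging and `DW W P`), (3∕4) `NE3CovariantAdjointTorus` (`D_W† = covDiv W`,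
the anti-involution `X ↦ −Xᴴ`, the torus Hodge split), (4∕4) `NE3SpectralCutTorus` (S2 and S1 in lattice currency + the S1∘S2 package).
THIS FILE (pure finite-dimensional linear algebra over a real inner-product space, Mathlib + the kit's file 1 only; all [folklore], 0 sorry, 0 def):
§1 `lowPart_add`∕`lowPart_smul`∕`lowPart_sub`, `highPart_add`∕`highPart_smul`∕`highPart_sub` (the coordinate truncations are `ℝ`-linear),
   `inner_lowPart_highPart = 0`, **`norm_sq_eq_add`** (`‖v‖² = ‖lowPart v‖² + ‖highPart v‖²`), and **`lowPart_map_comm`** ∕ `highPart_map_comm`: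
   for a symmetric `T` and ANY linear `J` with `T ∘ J = J ∘ T`, `lowPart hT θ (J v) = J (lowPart hT θ v)` — eigenvectors of `T` with distinct
   eigenvalues are orthogonal after `J` (`inner_eigenvectorBasis_map_eq_zero`), so `J` maps the `< θ` eigen-span into itself and the `≥ θ` one
   into itself (`lowPart_eq_self_of_inner_eq_zero`, `lowPart_eq_zero_of_inner_eq_zero`); hence a `J`-fixed vector has `J`-fixed parts
   (`map_lowPart_eq_of_map_eq`, `map_highPart_eq_of_map_eq`) — used in file 4 with `J = (X ↦ −Xᴴ)` sitewise: the cut of a 𝔲(n)-valued section is 𝔲(n)-valued;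
§2 `eq_of_add_eq_add_of_mem_orthogonal`: `r₁ + z₁ = r₂ + z₂` with `rᵢ ∈ K`, `zᵢ ∈ Kᗮ` forces `r₁ = r₂`, `z₁ = z₂` (used for the Hodge split in file 3).
HONEST FRAMING.  Finite-dimensional linear algebra on OUR lattice objects at ONE unitary background; nothing about Bałaban's minimisers;
(P♮)_W, (ML_w) at `W ≠ 1`, T-E_w and NE3 are NOT proved; spine PROVED 0∕9; finite T⁴ rung (B)+1 — NOT infinite volume, NOT mass gap, NOT
BetaPertH, NOT Clay.  ABSOLUTE RULE kept: no printed sentence is a hypothesis (context only: [Balaban1985Averaging] (17)–(19) pp. 20–21, the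
normalised Hilbert–Schmidt scalar product; [Balaban1985Variational] (83) p. 290, the Landau-gauge restriction).  PLACEMENT:
`Summits/QuantumFields/BalabanUV/` (our frame); moves nothing.  HONEST DEPENDENCY: continuum YM on T⁴ ⇐ BetaPertH ∧ nine spine estimates
(0/9 proved); BetaPertH ⇐ (D1) ∧ (D4) ∧ CAP+tail; G-an2-4 gates asym, D1 and NE2/3/4.
-/

set_option autoImplicit false

open scoped BigOperators InnerProductSpace
open Finset

namespace Summit.QuantumFields.BalabanUV.T4Continuum.NE3SpectralCutSymmetry

open NE3SpectralCut

noncomputable section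

/-! ## §1 Linearity, Pythagoras, and symmetries of the cut -/

section Abstract

variable {E : Type*} [NormedAddCommGroup E] [InnerProductSpace ℝ E] [FiniteDimensional ℝ E]
variable {T : E →ₗ[ℝ] E}

/-- `lowCoeff` is additive in the vector. [folklore] -/
theorem lowCoeff_add (hT : T.IsSymmetric) (θ : ℝ) (v w : E) (i : Fin (Module.finrank ℝ E)) :
    lowCoeff hT θ (v + w) i = lowCoeff hT θ v i + lowCoeff hT θ w i := by
  unfold lowCoeff
  split_ifs <;> simp

/-- `lowCoeff` commutes with real scalars. [folklore] -/
theorem lowCoeff_smul (hT : T.IsSymmetric) (θ : ℝ) (t : ℝ) (v : E) (i : Fin (Module.finrank ℝ E)) :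
    lowCoeff hT θ (t • v) i = t * lowCoeff hT θ v i := by
  unfold lowCoeff
  split_ifs <;> simp

/-- `highCoeff` is additive in the vector. [folklore] -/
theorem highCoeff_add (hT : T.IsSymmetric) (θ : ℝ) (v w : E) (i : Fin (Module.finrank ℝ E)) :
    highCoeff hT θ (v + w) i = highCoeff hT θ v i + highCoeff hT θ w i := by
  unfold highCoeff
  split_ifs <;> simp

/-- `highCoeff` commutes with real scalars. [folklore] -/
theorem highCoeff_smul (hT : T.IsSymmetric) (θ : ℝ) (t : ℝ) (v : E) (i : Fin (Module.finrank ℝ E)) :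
    highCoeff hT θ (t • v) i = t * highCoeff hT θ v i := by
  unfold highCoeff
  split_ifs <;> simp

/-- **`lowPart` is additive.** [folklore] -/
theorem lowPart_add (hT : T.IsSymmetric) (θ : ℝ) (v w : E) : lowPart hT θ (v + w) = lowPart hT θ v + lowPart hT θ w := by
  unfold lowPart
  rw [← Finset.sum_add_distrib]
  exact Finset.sum_congr rfl fun i _ => by rw [lowCoeff_add, add_smul]

/-- **`lowPart` commutes with real scalars.** [folklore] -/
theorem lowPart_smul (hT : T.IsSymmetric) (θ : ℝ) (t : ℝ) (v : E) : lowPart hT θ (t • v) = t • lowPart hT θ v := by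
  unfold lowPart
  rw [Finset.smul_sum]
  exact Finset.sum_congr rfl fun i _ => by rw [lowCoeff_smul, smul_smul]

/-- **`highPart` is additive.** [folklore] -/
theorem highPart_add (hT : T.IsSymmetric) (θ : ℝ) (v w : E) : highPart hT θ (v + w) = highPart hT θ v + highPart hT θ w := by
  unfold highPart
  rw [← Finset.sum_add_distrib]
  exact Finset.sum_congr rfl fun i _ => by rw [highCoeff_add, add_smul]

/-- **`highPart` commutes with real scalars.** [folklore] -/
theorem highPart_smul (hT : T.IsSymmetric) (θ : ℝ) (t : ℝ) (v : E) : highPart hT θ (t • v) = t • highPart hT θ v := by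
  unfold highPart
  rw [Finset.smul_sum]
  exact Finset.sum_congr rfl fun i _ => by rw [highCoeff_smul, smul_smul]

/-- `lowPart (v − w) = lowPart v − lowPart w`. [folklore] -/
theorem lowPart_sub (hT : T.IsSymmetric) (θ : ℝ) (v w : E) : lowPart hT θ (v - w) = lowPart hT θ v - lowPart hT θ w := by
  rw [sub_eq_add_neg, lowPart_add, ← neg_one_smul ℝ w, lowPart_smul, neg_one_smul, ← sub_eq_add_neg]

/-- `highPart (v − w) = highPart v − highPart w`. [folklore] -/
theorem highPart_sub (hT : T.IsSymmetric) (θ : ℝ) (v w : E) : highPart hT θ (v - w) = highPart hT θ v - highPart hT θ w := by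
  rw [sub_eq_add_neg, highPart_add, ← neg_one_smul ℝ w, highPart_smul, neg_one_smul, ← sub_eq_add_neg]

/-- **THE PARTS ARE ORTHOGONAL**: `⟪lowPart v, highPart v⟫ = 0`. [folklore] -/
theorem inner_lowPart_highPart (hT : T.IsSymmetric) (θ : ℝ) (v w : E) : ⟪lowPart hT θ v, highPart hT θ w⟫_ℝ = 0 := by
  unfold lowPart highPart
  rw [inner_sum_smul_sum_smul]
  refine Finset.sum_eq_zero fun i _ => ?_
  unfold lowCoeff highCoeff
  split_ifs <;> simp

/-- **PLAIN-NORM PYTHAGORAS**: `‖v‖² = ‖lowPart v‖² + ‖highPart v‖²`. [folklore] -/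
theorem norm_sq_eq_add (hT : T.IsSymmetric) (θ : ℝ) (v : E) : ‖v‖ ^ 2 = ‖lowPart hT θ v‖ ^ 2 + ‖highPart hT θ v‖ ^ 2 := by
  conv_lhs => rw [← lowPart_add_highPart hT θ v]
  rw [← real_inner_self_eq_norm_sq, inner_add_left, inner_add_right, inner_add_right, inner_lowPart_highPart,
    real_inner_comm (lowPart hT θ v) (highPart hT θ v), inner_lowPart_highPart, real_inner_self_eq_norm_sq,
    real_inner_self_eq_norm_sq]
  ring

/-- Each plain norm is at most the total: `‖highPart v‖ ^ 2 ≤ ‖v‖ ^ 2`. [folklore] -/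
theorem norm_sq_highPart_le_norm_sq (hT : T.IsSymmetric) (θ : ℝ) (v : E) : ‖highPart hT θ v‖ ^ 2 ≤ ‖v‖ ^ 2 := by
  rw [norm_sq_eq_add hT θ v]; nlinarith [sq_nonneg ‖lowPart hT θ v‖]

/-- … and `‖lowPart v‖ ^ 2 ≤ ‖v‖ ^ 2`. [folklore] -/
theorem norm_sq_lowPart_le_norm_sq (hT : T.IsSymmetric) (θ : ℝ) (v : E) : ‖lowPart hT θ v‖ ^ 2 ≤ ‖v‖ ^ 2 := by
  rw [norm_sq_eq_add hT θ v]; nlinarith [sq_nonneg ‖highPart hT θ v‖]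

/-- Eigenvectors of a symmetric `T` with DISTINCT eigenvalues stay orthogonal after any linear `J` commuting with `T`:
`⟪b_i, J b_j⟫ = 0` when `μ_i ≠ μ_j`. [folklore] -/
theorem inner_eigenvectorBasis_map_eq_zero (hT : T.IsSymmetric) (J : E →ₗ[ℝ] E)
    (hTJ : ∀ x : E, T (J x) = J (T x)) {i j : Fin (Module.finrank ℝ E)} (hne : hT.eigenvalues rfl i ≠ hT.eigenvalues rfl j) :
    ⟪hT.eigenvectorBasis rfl i, J (hT.eigenvectorBasis rfl j)⟫_ℝ = 0 := by
  set s := ⟪hT.eigenvectorBasis rfl i, J (hT.eigenvectorBasis rfl j)⟫_ℝ with hs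
  have h1 : ⟪T (hT.eigenvectorBasis rfl i), J (hT.eigenvectorBasis rfl j)⟫_ℝ = hT.eigenvalues rfl i * s := by
    rw [hT.apply_eigenvectorBasis, hs]
    simp [real_inner_smul_left]
  have h2 : ⟪T (hT.eigenvectorBasis rfl i), J (hT.eigenvectorBasis rfl j)⟫_ℝ = hT.eigenvalues rfl j * s := by
    rw [hT _ _, hTJ, hT.apply_eigenvectorBasis, hs]
    simp [real_inner_smul_right]
  have h3 : (hT.eigenvalues rfl i - hT.eigenvalues rfl j) * s = 0 := by rw [sub_mul, ← h1, ← h2, sub_self]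
  rcases mul_eq_zero.1 h3 with h | h
  · exact absurd (sub_eq_zero.1 h) hne
  · exact h

/-- A vector orthogonal to every eigenvector with eigenvalue `≥ θ` is its own low part. [folklore] -/
theorem lowPart_eq_self_of_inner_eq_zero (hT : T.IsSymmetric) (θ : ℝ) {w : E}
    (hw : ∀ j : Fin (Module.finrank ℝ E), θ ≤ hT.eigenvalues rfl j → ⟪hT.eigenvectorBasis rfl j, w⟫_ℝ = 0) :
    lowPart hT θ w = w := by
  unfold lowPart
  conv_rhs => rw [← (hT.eigenvectorBasis rfl).sum_repr w]
  refine Finset.sum_congr rfl fun i _ => ?_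
  unfold lowCoeff
  split_ifs with h
  · rfl
  · rw [(hT.eigenvectorBasis rfl).repr_apply_apply, hw i (le_of_not_gt h)]

/-- A vector orthogonal to every eigenvector with eigenvalue `< θ` has zero low part. [folklore] -/
theorem lowPart_eq_zero_of_inner_eq_zero (hT : T.IsSymmetric) (θ : ℝ) {w : E}
    (hw : ∀ i : Fin (Module.finrank ℝ E), hT.eigenvalues rfl i < θ → ⟪hT.eigenvectorBasis rfl i, w⟫_ℝ = 0) :
    lowPart hT θ w = 0 := by
  unfold lowPart
  refine Finset.sum_eq_zero fun i _ => ?_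
  unfold lowCoeff
  split_ifs with h
  · rw [(hT.eigenvectorBasis rfl).repr_apply_apply, hw i h, zero_smul]
  · rw [zero_smul]

/-- **THE CUT COMMUTES WITH EVERY LINEAR MAP COMMUTING WITH `T`**: `T ∘ J = J ∘ T` ⇒
`lowPart hT θ (J v) = J (lowPart hT θ v)` (the spectral projections are polynomials in `T`). [folklore] -/
theorem lowPart_map_comm (hT : T.IsSymmetric) (θ : ℝ) (J : E →ₗ[ℝ] E)
    (hTJ : ∀ x : E, T (J x) = J (T x)) (v : E) : lowPart hT θ (J v) = J (lowPart hT θ v) := by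
  have hsplit : J v = J (lowPart hT θ v) + J (highPart hT θ v) := by rw [← map_add, lowPart_add_highPart]
  -- `J (lowPart v)` is orthogonal to the `≥ θ` eigenvectors
  have hlow : ∀ j : Fin (Module.finrank ℝ E), θ ≤ hT.eigenvalues rfl j →
      ⟪hT.eigenvectorBasis rfl j, J (lowPart hT θ v)⟫_ℝ = 0 := by
    intro j hj
    unfold lowPart
    rw [map_sum, inner_sum]
    refine Finset.sum_eq_zero fun i _ => ?_
    rw [map_smul, real_inner_smul_right]
    unfold lowCoeff
    split_ifs with h
    · have hne : hT.eigenvalues rfl j ≠ hT.eigenvalues rfl i := fun heq => by rw [heq] at hj; exact absurd h (not_lt.2 hj)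
      rw [inner_eigenvectorBasis_map_eq_zero hT J hTJ hne, mul_zero]
    · rw [zero_mul]
  -- `J (highPart v)` is orthogonal to the `< θ` eigenvectors
  have hhigh : ∀ i : Fin (Module.finrank ℝ E), hT.eigenvalues rfl i < θ →
      ⟪hT.eigenvectorBasis rfl i, J (highPart hT θ v)⟫_ℝ = 0 := by
    intro i hi
    unfold highPart
    rw [map_sum, inner_sum]
    refine Finset.sum_eq_zero fun j _ => ?_
    rw [map_smul, real_inner_smul_right]
    unfold highCoeff
    split_ifs with h
    · rw [zero_mul]
    · have hne : hT.eigenvalues rfl i ≠ hT.eigenvalues rfl j := fun heq => by rw [heq] at hi; exact absurd hi h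
      rw [inner_eigenvectorBasis_map_eq_zero hT J hTJ hne, mul_zero]
  rw [hsplit, lowPart_add, lowPart_eq_self_of_inner_eq_zero hT θ hlow, lowPart_eq_zero_of_inner_eq_zero hT θ hhigh, add_zero]

/-- … and `highPart hT θ (J v) = J (highPart hT θ v)`. [folklore] -/
theorem highPart_map_comm (hT : T.IsSymmetric) (θ : ℝ) (J : E →ₗ[ℝ] E)
    (hTJ : ∀ x : E, T (J x) = J (T x)) (v : E) : highPart hT θ (J v) = J (highPart hT θ v) := by
  have h1 := lowPart_add_highPart hT θ (J v)
  have h2 : J (lowPart hT θ v) + J (highPart hT θ v) = J v := by rw [← map_add, lowPart_add_highPart]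
  rw [lowPart_map_comm hT θ J hTJ] at h1
  exact add_left_cancel (h1.trans h2.symm)

/-- A `J`-fixed vector has a `J`-fixed low part. [folklore] -/
theorem map_lowPart_eq_of_map_eq (hT : T.IsSymmetric) (θ : ℝ) (J : E →ₗ[ℝ] E)
    (hTJ : ∀ x : E, T (J x) = J (T x)) {v : E} (hv : J v = v) : J (lowPart hT θ v) = lowPart hT θ v := by
  rw [← lowPart_map_comm hT θ J hTJ, hv]

/-- A `J`-fixed vector has a `J`-fixed high part. [folklore] -/
theorem map_highPart_eq_of_map_eq (hT : T.IsSymmetric) (θ : ℝ) (J : E →ₗ[ℝ] E)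
    (hTJ : ∀ x : E, T (J x) = J (T x)) {v : E} (hv : J v = v) : J (highPart hT θ v) = highPart hT θ v := by
  rw [← highPart_map_comm hT θ J hTJ, hv]

end Abstract


/-! ## §2 Uniqueness of an orthogonal splitting -/

section Ortho

variable {E : Type*} [NormedAddCommGroup E] [InnerProductSpace ℝ E]

/-- **UNIQUENESS OF AN ORTHOGONAL SPLITTING**: `r₁ + z₁ = r₂ + z₂` with `rᵢ ∈ K`, `zᵢ ∈ Kᗮ` forces `r₁ = r₂` and `z₁ = z₂`. [folklore] -/
theorem eq_of_add_eq_add_of_mem_orthogonal {K : Submodule ℝ E} {r₁ r₂ z₁ z₂ : E} (hr₁ : r₁ ∈ K) (hr₂ : r₂ ∈ K) (hz₁ : z₁ ∈ Kᗮ)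
    (hz₂ : z₂ ∈ Kᗮ) (h : r₁ + z₁ = r₂ + z₂) : r₁ = r₂ ∧ z₁ = z₂ := by
  have hd : r₁ - r₂ = z₂ - z₁ := by rw [sub_eq_sub_iff_add_eq_add, h, add_comm]
  have hK : r₁ - r₂ ∈ K := K.sub_mem hr₁ hr₂
  have hKo : r₁ - r₂ ∈ Kᗮ := by rw [hd]; exact Kᗮ.sub_mem hz₂ hz₁
  have h0 : ⟪r₁ - r₂, r₁ - r₂⟫_ℝ = 0 := Submodule.inner_right_of_mem_orthogonal hK hKo
  have hr : r₁ = r₂ := sub_eq_zero.1 (inner_self_eq_zero.1 h0)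
  refine ⟨hr, ?_⟩
  rw [hr] at h
  exact add_left_cancel h

end Ortho

end

end Summit.QuantumFields.BalabanUV.T4Continuum.NE3SpectralCutSymmetry
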